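import Summits.BirchSwinnertonDyer.BirchSwinnertonDyer.Theorems.EisensteinPrimesMazurMCOnCellBTwistbackReverseEdgeTwoFields
import HarnessLib

/-!
# Crux 3 `MazurMCOnCellB` (stmt-BirchSwinnertonDyer-19033), line `twistback` — the TWO-FIELD ENGINE for reverse two-step edges
# (data form over two disjoint sublists of the odd bad primes; every odd `p`; companion of `…TwistbackReverseEdgeTwoFields`)

Width seat bsd-line-x2-p1-w6 (gen 23), cell `bsd-eis` (run/shared/lean/pub/bsd-eis/), 2026-08-30; lane (η) #9;
`--supports stmt-BirchSwinnertonDyer-19033 --as helper`. THEOREMS ONLY (no `def`, no named fact, no `sorry`, no instance). The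
registered line `twistback` v13b is NOT touched; nothing here closes a stub.

WHAT. Gen 22's engine `…KernelCertP13NoReverseEdge.exists_sublist_of_twoStepAt_into` unfolds a reverse edge `TwoStepAt 13 U W` into ONE
sublist `S` of the odd bad primes of `W` (the support of the SECOND field `d_{K″} = −∏S`) with residue conditions, and
`not_twoStepAt_into_of_check` closes a cell when a `decide` enumeration of the sublists refutes them. By `TwoStepAt.twoFields`
(companion file) the FIRST field is constrained the same way: `d_K = −∏T` for a second sublist `T`, DISJOINT from `S`, with `∏T > 4`,
`−∏T ≡ 1 (mod 8)` (when `2 ∣ N_W`), `−∏T` a square mod `p`, `(−∏T / q) = 1` at every odd bad `q` outside `S ∪ T` (`K` Heegner for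
`N_U`, `U ≅ W ⊗ χ_{∏S ∏T}` good exactly at `S ∪ T` among the odd bad primes), `(−∏S / q) = 1` at every odd bad `q` outside `S` — in
particular at `q ∈ T` (`K″` Heegner for `N_{Ud}`, `Ud ≅ W ⊗ χ_{−∏S}` additive at `T`) —, no exponent-one prime in `S ∪ T`. This file
states that data form for every odd `p` (`exists_sublists_of_twoStepAt_into₂`), the empty-enumeration closer
(`not_twoStepAt_into_of_check₂`), and (§2) the structural closer in the same certificate vocabulary
(`not_twoStepAt_into_of_cover_psm`: every odd bad prime but one of exponent one ⇒ in-degree zero at every `p`, no enumeration —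
`not_twoStepAt_into_of_sq_subsingleton` of the companion). USE: a per-class certificate feeds `reverseData_of_cert` (gen 22) and
either `hone` (a `decide` on the lists) or a `decide` over pairs of sublists. ATLAS DATUM (memo `P13-TWO-FIELDS-w6g23.md`): with both fields priced, 0 of the 2627 X2b classes at
`13` in the lane's census admit a candidate pair (gen 22, second field only: 36).

HONEST FRAMING: elementary kernel facts about conductors of quadratic twists, fundamental discriminants, quadratic residues and the
Heegner hypothesis; nothing about any L-value, Selmer group, Ш, main conjecture or BSD is asserted; closes no registered stub; 0 cells /
labels / stubs / tiers move; no summit statement, no case of Mazur's main conjecture and no case of BSD is proved for any curve.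
References: [GrossLMS1991] §1 (p. 235); [IrelandRosen1990] Prop. 5.1.1, 13.1.3–13.1.4; [SilvermanAEC2009] VII.5 Prop. 5.1(c), App. C §16;
gen 22 `…KernelCertP13NoReverseEdge` (p768810), gen 21 `…DoorPrice` (p764408) / `…DoorPriceClassI` (p766256).
-/

set_option autoImplicit false
-- `Summit.BirchSwinnertonDyer.BirchSwinnertonDyer.…`: the summit and its single sub-problem share a name.
set_option linter.dupNamespace false

noncomputable section

open scoped Classical
open WeierstrassCurve NumberField Literature.NumberTheory.EllipticCurves
  Literature.NumberTheory.EllipticCurves.ModularForms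
  Literature.NumberTheory.QuadraticFields
  IsDedekindDomain Rat.HeightOneSpectrum
  Summit.BirchSwinnertonDyer.Rank1Residual
  Summit.BirchSwinnertonDyer.BirchSwinnertonDyer.Theorems
  Summit.BirchSwinnertonDyer.BirchSwinnertonDyer.Theorems.EisensteinPrimesMazurMCOnCellBTwistbackTwoStepDefs
  Summit.BirchSwinnertonDyer.BirchSwinnertonDyer.Theorems.EisensteinPrimesMazurMCOnCellBKernelCertP13DoorPrice
  Summit.BirchSwinnertonDyer.BirchSwinnertonDyer.Theorems.EisensteinPrimesMazurMCOnCellBKernelCertP13DoorPriceClassI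
  Summit.BirchSwinnertonDyer.BirchSwinnertonDyer.Theorems.EisensteinPrimesMazurMCOnCellBKernelCertP13NoReverseEdge
  Summit.BirchSwinnertonDyer.BirchSwinnertonDyer.Theorems.EisensteinPrimesMazurMCOnCellBTwistbackReverseEdgeTwoFields

namespace Summit.BirchSwinnertonDyer.BirchSwinnertonDyer.Theorems.EisensteinPrimesMazurMCOnCellBTwistbackReverseEdgeTwoFieldsEngine

/-! ## §1 The two-field engine (data form; every odd `p`; refines gen 22's `exists_sublist_of_twoStepAt_into`) -/

/-- **TWO-FIELD ENGINE (data form).** For an elliptic `W` with `2 ∣ N_W`, `ps` a nodup list of odd primes dividing `N_W` such that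
every prime of `N_W` is `2` or in `ps`, and `psm ⊆` primes `q` with `q² ∤ N_W`: a reverse edge `TwoStepAt p U W` (`p` odd) yields TWO
sublists `S` (support of `d_{K″}`) and `T` (support of `d_K`) of `ps`, with `∏S, ∏T > 4`, `−∏S ≡ −∏T ≡ 1 (mod 8)`, both
`(p−1)/2`-th powers `= 1` in `𝔽_p`, `T` disjoint from `S`, `q ∣ ∏S ∨ (−∏S / q) = 1` for `q ∈ ps` (`K″` Heegner for `N_{Ud}`),
`q ∣ ∏S ∨ q ∣ ∏T ∨ (−∏T / q) = 1` for `q ∈ ps` (`K` Heegner for `N_U`), no `psm`-prime in `S` or `T`, together with curves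
`Ud ≅ W ⊗ χ_{−∏S}` good at the primes of `S` and `U ≅ W ⊗ χ_{∏S·∏T}` good at the primes of `S` and of `T`.
[cite: GrossLMS1991, §1 (p. 235)] [cite: IrelandRosen1990, Prop. 13.1.3–13.1.4 and Prop. 5.1.1] -/
theorem exists_sublists_of_twoStepAt_into₂ {p : ℕ} [Fact p.Prime] (hp2 : p ≠ 2) {W : WeierstrassCurve ℚ} [W.IsElliptic]
    (ps psm : List ℕ) (hnd : ps.Nodup)
    (h2 : 2 ∣ W.conductorNorm ℤ) (hps : ∀ q ∈ ps, q.Prime ∧ q ≠ 2 ∧ q ∣ W.conductorNorm ℤ)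
    (hcover : ∀ ℓ : ℕ, ℓ.Prime → ℓ ∣ W.conductorNorm ℤ → ℓ = 2 ∨ ℓ ∈ ps)
    (hpsm : ∀ q ∈ psm, q.Prime ∧ ¬ q ^ 2 ∣ W.conductorNorm ℤ)
    (U : WeierstrassCurve ℚ) (h : TwoStepAt p U W) :
    ∃ S ∈ ps.sublists, ∃ T ∈ ps.sublists, 4 < S.prod ∧ 4 < T.prod ∧
      (-(S.prod : ℤ)) % 8 = 1 ∧ (-(T.prod : ℤ)) % 8 = 1 ∧
      ((-(S.prod : ℤ) : ℤ) : ZMod p) ^ (p / 2) = 1 ∧ ((-(T.prod : ℤ) : ℤ) : ZMod p) ^ (p / 2) = 1 ∧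
      (∀ q ∈ T, ¬ q ∣ S.prod) ∧
      (∀ q ∈ ps, (q : ℤ) ∣ -(S.prod : ℤ) ∨ ((-(S.prod : ℤ) : ℤ) : ZMod q) ^ (q / 2) = 1) ∧
      (∀ q ∈ ps, (q : ℤ) ∣ -(S.prod : ℤ) ∨ (q : ℤ) ∣ -(T.prod : ℤ) ∨ ((-(T.prod : ℤ) : ℤ) : ZMod q) ^ (q / 2) = 1) ∧
      (∀ q ∈ psm, ¬ q ∣ S.prod ∧ ¬ q ∣ T.prod) ∧
      ∃ (Ud : WeierstrassCurve ℚ) (_ : Ud.IsElliptic) (_ : U.IsElliptic),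
        (∃ C : VariableChange ℚ, C • Ud = W.quadraticTwist (-(S.prod : ℚ))) ∧
        (∃ C : VariableChange ℚ, C • U = W.quadraticTwist ((S.prod : ℚ) * (T.prod : ℚ))) ∧
        (∀ q : ℕ, q.Prime → q ∣ S.prod → ¬ q ∣ Ud.conductorNorm ℤ) ∧
        (∀ q : ℕ, q.Prime → q ∣ S.prod ∨ q ∣ T.prod → ¬ q ∣ U.conductorNorm ℤ) := by
  obtain ⟨hUE, _, K, _, _, Ud, hUdE, _, K'', _, _, hK, hHN, hHp, hodd, hlt, hK'', hHN'', hHp'', hodd'', hlt'', ⟨C₂', hC₂'⟩,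
    ⟨C₃, hC₃⟩, hA, hB, hC, hD⟩ := TwoStepAt.twoFields h
  -- dyadic and `p`-adic residues
  have h2d : ¬ (2 : ℤ) ∣ NumberField.discr K := by rw [Int.odd_iff] at hodd; omega
  have h2d'' : ¬ (2 : ℤ) ∣ NumberField.discr K'' := by rw [Int.odd_iff] at hodd''; omega
  have h8'' : NumberField.discr K'' % 8 = 1 :=
    discr_emod_eight_of_heegner hK'' hHN'' (hC 2 Nat.prime_two h2 (by exact_mod_cast h2d''))
  have h8 : NumberField.discr K % 8 = 1 :=
    discr_emod_eight_of_heegner hK hHN (hD 2 Nat.prime_two h2 (by exact_mod_cast h2d) (by exact_mod_cast h2d''))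
  have hpp'' : ((NumberField.discr K'' : ℤ) : ZMod p) ^ (p / 2) = 1 :=
    discr_pow_eq_one_of_heegner hK'' hHp'' p hp2 (dvd_refl p)
  have hpp : ((NumberField.discr K : ℤ) : ZMod p) ^ (p / 2) = 1 :=
    discr_pow_eq_one_of_heegner hK hHp p hp2 (dvd_refl p)
  -- residues at the odd bad primes
  have hres'' : ∀ q ∈ ps, (q : ℤ) ∣ NumberField.discr K'' ∨ ((NumberField.discr K'' : ℤ) : ZMod q) ^ (q / 2) = 1 := by
    intro q hq
    obtain ⟨hqp, hq2, hqN⟩ := hps q hq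
    by_cases hqd : (q : ℤ) ∣ NumberField.discr K''
    · exact Or.inl hqd
    · haveI : Fact q.Prime := ⟨hqp⟩
      exact Or.inr (discr_pow_eq_one_of_heegner hK'' hHN'' q hq2 (hC q hqp hqN hqd))
  have hres : ∀ q ∈ ps, (q : ℤ) ∣ NumberField.discr K'' ∨ (q : ℤ) ∣ NumberField.discr K ∨
      ((NumberField.discr K : ℤ) : ZMod q) ^ (q / 2) = 1 := by
    intro q hq
    obtain ⟨hqp, hq2, hqN⟩ := hps q hq
    by_cases hqd'' : (q : ℤ) ∣ NumberField.discr K''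
    · exact Or.inl hqd''
    · by_cases hqd : (q : ℤ) ∣ NumberField.discr K
      · exact Or.inr (Or.inl hqd)
      · haveI : Fact q.Prime := ⟨hqp⟩
        exact Or.inr (Or.inr (discr_pow_eq_one_of_heegner hK hHN q hq2 (hD q hqp hqN hqd hqd'')))
  -- supports: every prime of either discriminant is in `ps`; the discriminants are squarefree
  have hmem'' : ∀ ℓ : ℕ, ℓ.Prime → ℓ ∣ (NumberField.discr K'').natAbs → ℓ ∈ ps := by
    intro ℓ hℓ hℓd
    have hℓd' : (ℓ : ℤ) ∣ NumberField.discr K'' := Int.natCast_dvd.mpr hℓd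
    have hℓN : ℓ ∣ W.conductorNorm ℤ := (dvd_pow_self ℓ two_ne_zero).trans (hA ℓ hℓ hℓd').1
    rcases hcover ℓ hℓ hℓN with rfl | hm
    · exfalso; rw [Int.odd_iff] at hodd''; omega
    · exact hm
  have hmem : ∀ ℓ : ℕ, ℓ.Prime → ℓ ∣ (NumberField.discr K).natAbs → ℓ ∈ ps := by
    intro ℓ hℓ hℓd
    have hℓd' : (ℓ : ℤ) ∣ NumberField.discr K := Int.natCast_dvd.mpr hℓd
    have hℓN : ℓ ∣ W.conductorNorm ℤ := (dvd_pow_self ℓ two_ne_zero).trans (hB ℓ hℓ hℓd').1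
    rcases hcover ℓ hℓ hℓN with rfl | hm
    · exfalso; rw [Int.odd_iff] at hodd; omega
    · exact hm
  have hsqf'' : Squarefree (NumberField.discr K'').natAbs := by
    rcases Quadratic.isFundamentalDiscriminant_discr hK''.1 with ⟨-, hsf, -⟩ | ⟨h4, -, -⟩
    · exact Int.squarefree_natAbs.mpr hsf
    · exfalso; rw [Int.odd_iff] at hodd''; omega
  have hsqf : Squarefree (NumberField.discr K).natAbs := by
    rcases Quadratic.isFundamentalDiscriminant_discr hK.1 with ⟨-, hsf, -⟩ | ⟨h4, -, -⟩
    · exact Int.squarefree_natAbs.mpr hsf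
    · exfalso; rw [Int.odd_iff] at hodd; omega
  set S := ps.filter (· ∣ (NumberField.discr K'').natAbs) with hS
  set T := ps.filter (· ∣ (NumberField.discr K).natAbs) with hT
  have hSprod : S.prod = (NumberField.discr K'').natAbs :=
    prod_filter_dvd_eq ps hnd (fun q hq => (hps q hq).1) _ hsqf'' hmem''
  have hTprod : T.prod = (NumberField.discr K).natAbs :=
    prod_filter_dvd_eq ps hnd (fun q hq => (hps q hq).1) _ hsqf hmem
  have hdS : NumberField.discr K'' = -(S.prod : ℤ) := by rw [hSprod]; omega
  have hdT : NumberField.discr K = -(T.prod : ℤ) := by rw [hTprod]; omega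
  refine ⟨S, List.mem_sublists.mpr (List.filter_sublist), T, List.mem_sublists.mpr (List.filter_sublist),
    by rw [hSprod]; omega, by rw [hTprod]; omega, by rw [← hdS]; exact h8'', by rw [← hdT]; exact h8,
    by rw [← hdS]; exact hpp'', by rw [← hdT]; exact hpp, ?_, by rw [← hdS]; exact hres'', by rw [← hdS, ← hdT]; exact hres, ?_,
    Ud, hUdE, hUE, ⟨C₂', by rw [hC₂', hdS, Int.cast_neg, Int.cast_natCast]⟩, ⟨C₃, ?_⟩, ?_, ?_⟩
  · -- `T` is disjoint from `S`
    intro q hq hqS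
    have hq' := List.mem_filter.mp hq
    have hqd : (q : ℤ) ∣ NumberField.discr K := by
      have : q ∣ (NumberField.discr K).natAbs := by simpa using hq'.2
      exact Int.natCast_dvd.mpr this
    have hqd'' : (q : ℤ) ∣ NumberField.discr K'' := by
      rw [hdS]; exact dvd_neg.mpr (Int.natCast_dvd_natCast.mpr hqS)
    exact (hB q (hps q hq'.1).1 hqd).2.2.1 hqd''
  · -- no exponent-one prime in either support
    intro q hq
    obtain ⟨hqp, hqsq⟩ := hpsm q hq
    refine ⟨fun hqS ↦ ?_, fun hqT ↦ ?_⟩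
    · have hqd : (q : ℤ) ∣ NumberField.discr K'' := by
        rw [hdS]; exact dvd_neg.mpr (Int.natCast_dvd_natCast.mpr hqS)
      exact hqsq (hA q hqp hqd).1
    · have hqd : (q : ℤ) ∣ NumberField.discr K := by
        rw [hdT]; exact dvd_neg.mpr (Int.natCast_dvd_natCast.mpr hqT)
      exact hqsq (hB q hqp hqd).1
  · -- the source is a model of `W ⊗ χ_{∏S ∏T}`
    rw [hC₃, hdS, hdT, neg_mul_neg, Int.cast_mul, Int.cast_natCast, Int.cast_natCast]
  · -- the middle curve is good at the primes of `S`
    intro q hq hqS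
    have hqd : (q : ℤ) ∣ NumberField.discr K'' := by
      rw [hdS]; exact dvd_neg.mpr (Int.natCast_dvd_natCast.mpr hqS)
    exact (hA q hq hqd).2.1
  · -- the source is good at the primes of `S` and of `T`
    rintro q hq (hqS | hqT)
    · have hqd : (q : ℤ) ∣ NumberField.discr K'' := by
        rw [hdS]; exact dvd_neg.mpr (Int.natCast_dvd_natCast.mpr hqS)
      exact (hA q hq hqd).2.2
    · have hqd : (q : ℤ) ∣ NumberField.discr K := by
        rw [hdT]; exact dvd_neg.mpr (Int.natCast_dvd_natCast.mpr hqT)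
      exact (hB q hq hqd).2.2.2

/-- **TWO-FIELD ENGINE, empty case.** If a `decide`-able enumeration over the PAIRS of sublists of `ps` refutes the conditions of
`exists_sublists_of_twoStepAt_into₂`, there is NO reverse edge into `W` at `p`. (Gen 22's `not_twoStepAt_into_of_check` is the weaker
test ignoring `T`.) [cite: GrossLMS1991, §1 (p. 235)] -/
theorem not_twoStepAt_into_of_check₂ {p : ℕ} [Fact p.Prime] (hp2 : p ≠ 2) {W : WeierstrassCurve ℚ} [W.IsElliptic]
    (ps psm : List ℕ) (hnd : ps.Nodup)
    (h2 : 2 ∣ W.conductorNorm ℤ) (hps : ∀ q ∈ ps, q.Prime ∧ q ≠ 2 ∧ q ∣ W.conductorNorm ℤ)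
    (hcover : ∀ ℓ : ℕ, ℓ.Prime → ℓ ∣ W.conductorNorm ℤ → ℓ = 2 ∨ ℓ ∈ ps)
    (hpsm : ∀ q ∈ psm, q.Prime ∧ ¬ q ^ 2 ∣ W.conductorNorm ℤ)
    (hcheck : ∀ S ∈ ps.sublists, ∀ T ∈ ps.sublists, 4 < S.prod → 4 < T.prod →
      (-(S.prod : ℤ)) % 8 = 1 → (-(T.prod : ℤ)) % 8 = 1 →
      ((-(S.prod : ℤ) : ℤ) : ZMod p) ^ (p / 2) = 1 → ((-(T.prod : ℤ) : ℤ) : ZMod p) ^ (p / 2) = 1 →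
      (∀ q ∈ T, ¬ q ∣ S.prod) →
      (∀ q ∈ ps, (q : ℤ) ∣ -(S.prod : ℤ) ∨ ((-(S.prod : ℤ) : ℤ) : ZMod q) ^ (q / 2) = 1) →
      (∀ q ∈ ps, (q : ℤ) ∣ -(S.prod : ℤ) ∨ (q : ℤ) ∣ -(T.prod : ℤ) ∨ ((-(T.prod : ℤ) : ℤ) : ZMod q) ^ (q / 2) = 1) →
      (∀ q ∈ psm, ¬ q ∣ S.prod ∧ ¬ q ∣ T.prod) → False)
    (U : WeierstrassCurve ℚ) : ¬ TwoStepAt p U W := fun h => by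
  obtain ⟨S, hS, T, hT, h4S, h4T, h8S, h8T, hpS, hpT, hdisj, hresS, hresT, hm, -⟩ :=
    exists_sublists_of_twoStepAt_into₂ hp2 ps psm hnd h2 hps hcover hpsm U h
  exact hcheck S hS T hT h4S h4T h8S h8T hpS hpT hdisj hresS hresT hm

/-! ## §2 The structural closer in certificate vocabulary (no enumeration) -/

/-- **At most one odd additive prime ⇒ in-degree zero, from certificate data.** With `ps` covering the odd primes of `N_W` and
`psm ⊆` exponent-one primes (the shape delivered by gen 22's `reverseData_of_cert` from an integer equation): if every prime of `ps`
other than a single `q₀` lies in `psm`, then NO reverse edge ends at `W`, at ANY `p` — by `not_twoStepAt_into_of_sq_subsingleton`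
(companion file), without any enumeration or residue check (`hone` is a `decide` on the lists). [cite: GrossLMS1991, §1 (p. 235)] -/
theorem not_twoStepAt_into_of_cover_psm {W : WeierstrassCurve ℚ} (ps psm : List ℕ) (q₀ : ℕ)
    (hcover : ∀ ℓ : ℕ, ℓ.Prime → ℓ ∣ W.conductorNorm ℤ → ℓ = 2 ∨ ℓ ∈ ps)
    (hpsm : ∀ q ∈ psm, q.Prime ∧ ¬ q ^ 2 ∣ W.conductorNorm ℤ)
    (hone : ∀ q ∈ ps, q ∈ psm ∨ q = q₀)
    (p : ℕ) (U : WeierstrassCurve ℚ) : ¬ TwoStepAt p U W := by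
  refine not_twoStepAt_into_of_sq_subsingleton (fun q₁ q₂ hq₁ hq₂ h12 h22 hsq₁ hsq₂ ↦ ?_) p U
  have key : ∀ q : ℕ, q.Prime → q ≠ 2 → q ^ 2 ∣ W.conductorNorm ℤ → q = q₀ := by
    intro q hq hq2 hsq
    rcases hcover q hq ((dvd_pow_self q two_ne_zero).trans hsq) with h | h
    · exact absurd h hq2
    · rcases hone q h with hm | hm
      · exact absurd hsq (hpsm q hm).2
      · exact hm
  rw [key q₁ hq₁ h12 hsq₁, key q₂ hq₂ h22 hsq₂]

end Summit.BirchSwinnertonDyer.BirchSwinnertonDyer.Theorems.EisensteinPrimesMazurMCOnCellBTwistbackReverseEdgeTwoFieldsEngine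

end
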